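import Summits.Ventures.AbcSig.Rows.XTemplateHalves
import Summits.Ventures.AbcSig.Levels.N10784

/-!
# Venture AbcSig — PARITY-HALF ROW `C2aL337A0xyodd`: `xⁿ + 337^m·yⁿ = z²`, `xy` odd (class `a = 0`, [BS04, Thm 1.6] wording) over the NORM-FORM level file 10784 = 32·337 (GENERATED by p-lean g4 `gen4/halfrow.py`)

HONEST FRAMING. A row of a COMPUTATION cell (`pub-abcsig`); a CONDITIONAL theorem, no claim on ABC or any summit.
Hypotheses: `BS04Package` (CITED: [BS04] Lemma 3.3 + (3.1) + Lemma 4.2); `DataComplete 10784` + `RefinesCPSymAll 10784` (COMPUTED: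
certified engine-1 level file; norm-form certificates `Sieve/CharpolyCert.lean`, prime-ideal trees where the norm form is weaker);
the listed per-orbit exclusions `hX_…` (CITED: the row of record's module closures — nothing of them is checked here).
Only the parity half living at the single level 32·337 is claimed (the complementary half needs level 2·337, not certified).
Exponent range: prime `n ≥ 11`, `n ≠ 337`, n ∉ [11]; `1 ≤ m < n`.
Residual of record R = {11} EXCLUDED in the statement (hres). CITED per the row of record's R3: 10784.10 @ 89: M4.
Row of record: `census/rows/C2a/C2a-l337-a0-xyodd.md` (sha16 `22b46f58df0bc37b`; SIGNED 2026-08-22T16:05:08Z by referee (ref-g11)).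
-/

namespace Summit.Ventures.AbcSig

/-- Parity-half row `C2aL337A0xyodd` (`xⁿ + 337^m·yⁿ = z²`, `xy` odd (class `a = 0`, [BS04, Thm 1.6] wording)); prime `n ≥ 11`, `n ≠ 337`, `n ∉ [11]`; conditional on the named hypotheses. -/
theorem xrow_C2aL337A0xyodd (M : NewformModel) (hP : M.BS04Package)
    (hD10784 : M.DataComplete 10784 level10784Orbits) (hCP10784 : M.RefinesCPSymAll 10784 level10784CP)
    (n : ℕ) (hn : n.Prime) (hmin : 11 ≤ n) (hnℓ : n ≠ 337) (hres : n ∉ ([11] : List ℕ)) (m : ℕ) (hm : 1 ≤ m) (hmn : m < n)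
    (hX_orbit_10784_10 : n ∈ ([89] : List ℕ) → M.Excludes 10784 orbit_10784_10
      (famB (2 ^ 0 * 337 ^ m) n (fun _ _ => True)))
    (x y z : ℤ) (hxy : ¬ 2 ∣ x * y) (hxy1 : x * y ≠ 1) (hxy2 : x * y ≠ -1) : ¬ IsPrimitiveSolution 1 (2 ^ 0 * 337 ^ m) 1 n x y z := by
  have hℓ : Nat.Prime 337 := by norm_num
  have h7 : 7 ≤ n := by omega
  exact xrowC2a_a0_xyodd 337 hℓ (by norm_num) M hP n hn h7 hnℓ hD10784 m hm hmn
    (level10784_sieve M hP hCP10784 n hn h7 (fun o => M.Excludes 10784 o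
      (famB (2 ^ 0 * 337 ^ m) n (fun _ _ => True)) ∨ M.ExcludesStd 10784 o n) (fun _ h => Or.inr h) (fun hmem => by
      obtain rfl : n = 11 := by simpa using hmem
      exact absurd (by simp) hres) (fun hmem => by
      obtain rfl : n = 11 := by simpa using hmem
      exact absurd (by simp) hres) (fun hmem => by
      obtain rfl : n = 11 := by simpa using hmem
      exact absurd (by simp) hres) (fun hmem => by
      obtain rfl : n = 89 := by simpa using hmem
      exact Or.inl (hX_orbit_10784_10 (by simp))))
    x y z hxy hxy1 hxy2

end Summit.Ventures.AbcSig
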